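import Summits.Schanuel.Schanuel.Theorems.DiophantineDichotomyApproximationPropertyDeficientLeverDefs
import Summits.Schanuel.Schanuel.Theorems.DiophantineDichotomyApproximationPropertyZeroDimDictionary
import HarnessLib

/-!
# The deficient 0-dimensional dictionary: `stub_zeroDimDictionaryDeficient : ZeroDimDictionaryDeficient` (stmt-Schanuel-6117)

Crux `stmt-Schanuel-6117`
(`Summit.Schanuel.Schanuel.Theses.DiophantineDichotomy.ApproximationProperty`), route
`DiophantineDichotomy`, line `orbit-interpolation-determinant`, lead c8. This file PROVES the
registered stub `stub_zeroDimDictionaryDeficient : ZeroDimDictionaryDeficient` of the checked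
skeleton (definitions module `DiophantineDichotomyApproximationPropertyDeficientLeverDefs.lean`):
the 0-dimensional dictionary `ZeroDimDictionary` (clauses (A), (B′), (B), (C), (D), (E), landed as
`stub_zeroDimDictionary` in `…ZeroDimDictionary.lean`) with the extra RANK-DEFICIENT interpolation
clause (E′): in the chart `b₀ ≠ 0`, for every degree `δ` and every
`r ≤ H(𝔭; δ) = dim ℚ[x̲]_δ − dim (ℚ[x̲]_δ ∩ 𝔭)` there are `r` exponent vectors `αⱼ ∈ ℕᵐ` of total
degree `≤ δ` whose monomials `∏ₗ (b_{l+1}/b₀)^{αⱼ l}` are `ℚ`-linearly independent in `K = ℚ(b̄)`.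

* `exists_linearIndependent_monomials` (E′) — the evaluation map `ev : ℚ[x̲]_δ → K`,
  `G ↦ G(b̄/b₀)`, has kernel `𝔭_δ` (landed `mem_iff_aeval_eq_zero`), hence rank `H(𝔭; δ) ≥ r`
  (rank–nullity); its range is spanned by the values of the MONOMIALS of degree `δ`
  (`homogeneousSubmodule = span of monomials`), which therefore contain `H(𝔭; δ)` linearly
  independent values (`Submodule.exists_fun_fin_finrank_span_eq`); dehomogenising a monomial `x̲ᵉ`,
  `|e| = δ`, at `(1, b₁/b₀, …, b_m/b₀)` gives `∏ₗ (b_{l+1}/b₀)^{e_{l+1}}`, exponent vector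
  `(e₁, …, e_m)` of total degree `≤ δ`;
* `stub_zeroDimDictionaryDeficient` — the assembly (verbatim the landed assembly of
  `stub_zeroDimDictionary`, same witnesses `c = m(m+1)/2 + log(m+1)`, `K = ℚ(b̄')`, `b̄`,
  plus (E′)).

Sources: Nesterenko, LNM 1752 Ch. 3 §4 (Prop. 4.4, Def. 4.6, Prop. 4.13), §5 (p. 42); Laurent–Roy
1999 (interpolation determinants); Philippon 1986 §1; the line's memos KERNEL-c6.md (R1),
KERNEL-c8.md (§4).
-/

noncomputable section

-- `Summit.Schanuel.Schanuel.…` is the mandated summit/sub-problem namespace (single-conjunct summit), hence: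
set_option linter.dupNamespace false

namespace Summit.Schanuel.Schanuel.Cruxes.ApproximationProperty.OrbitInterpolationDeterminant

open Literature.NumberTheory.Transcendental.Nesterenko MvPolynomial
open scoped BigOperators

variable {m : ℕ}

/-! ## §1  Deficient interpolation: `r ≤ H(𝔭; δ)` independent monomials of degree `≤ δ` -/

section Span

variable {𝔭 : Ideal (Rx m)}

/-- **(E′) Deficient interpolation**: if `b₀ ≠ 0` and
`r ≤ H(𝔭; δ) = dim ℚ[x̲]_δ − dim (ℚ[x̲]_δ ∩ 𝔭)`, then there are `r` exponent vectors `αⱼ ∈ ℕᵐ` of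
total degree `≤ δ` whose monomials in the affine coordinates `b₁/b₀, …, b_m/b₀` of the normalised
zero are `ℚ`-linearly independent in `K = ℚ(b̄')` (the evaluation map `ℚ[x̲]_δ → K`,
`G ↦ G(b̄/b₀)`, has kernel `𝔭_δ`, hence rank `H(𝔭; δ)`, and the values of the monomials of
degree `δ` span its range).
[cite: NesterenkoPhilippon2001, Ch. 3 §5 (p. 42), Prop. 4.13; Philippon1986Criteres, §1] -/
theorem exists_linearIndependent_monomials (h𝔭 : 𝔭.IsPrime)
    (hhom : letI := MvPolynomial.gradedAlgebra (σ := Fin (m + 1)) (R := ℚ);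
      𝔭.IsHomogeneous (homogeneousSubmodule (Fin (m + 1)) ℚ)) (hunm : IsUnmixedOfRank 𝔭 1)
    {b' : Fin (m + 1) → ℂ} (hb' : b' ∈ projZeros 𝔭) {j : Fin (m + 1)} (hj : b' j = 1)
    [NumberField ↥(IntermediateField.adjoin ℚ (Set.range b'))]
    {b : Fin (m + 1) → ↥(IntermediateField.adjoin ℚ (Set.range b'))} (hb : ∀ k, (b k : ℂ) = b' k)
    (hb0 : b 0 ≠ 0) (δ r : ℕ)
    (hr : r + Module.finrank ℚ ↥(homogeneousSubmodule (Fin (m + 1)) ℚ δ ⊓ 𝔭.restrictScalars ℚ) ≤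
      Module.finrank ℚ ↥(homogeneousSubmodule (Fin (m + 1)) ℚ δ)) :
    ∃ α : Fin r → Fin m → ℕ, (∀ j, ∑ l, α j l ≤ δ) ∧
      LinearIndependent ℚ (fun j => ∏ l, (b l.succ / b 0) ^ α j l) := by
  classical
  set a : Fin (m + 1) → ↥(IntermediateField.adjoin ℚ (Set.range b')) := fun k => b k / b 0 with ha
  have hba : b = b 0 • a := by
    funext k
    simp only [ha, Pi.smul_apply, smul_eq_mul]
    rw [mul_div_cancel₀ _ hb0]
  -- the kernel of `G ↦ G(a)` on the forms of degree `δ` is `𝔭_δ`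
  have hker : ∀ G : Rx m, G.IsHomogeneous δ → (aeval a G = 0 ↔ G ∈ 𝔭) := by
    intro G hG
    rw [mem_iff_aeval_eq_zero h𝔭 hhom hunm hb' hj hb hG, hba,
      Literature.NumberTheory.Transcendental.NesterenkoK.aeval_smul_of_isHomogeneous hG,
      mul_eq_zero, or_iff_right (pow_ne_zero _ hb0)]
  set W : Submodule ℚ (Rx m) := homogeneousSubmodule (Fin (m + 1)) ℚ δ with hW
  haveI : FiniteDimensional ℚ ↥W := Module.Finite.iff_fg.mpr (homogeneousSubmodule_fg _ _ δ)
  set ev : ↥W →ₗ[ℚ] ↥(IntermediateField.adjoin ℚ (Set.range b')) :=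
    (aeval a).toLinearMap.comp W.subtype with hev
  have hkerW : LinearMap.ker ev = Submodule.comap W.subtype (W ⊓ 𝔭.restrictScalars ℚ) := by
    ext ⟨G, hG⟩
    have hG' : G.IsHomogeneous δ := (mem_homogeneousSubmodule δ G).mp hG
    simp only [LinearMap.mem_ker, hev, LinearMap.comp_apply, Submodule.subtype_apply,
      AlgHom.toLinearMap_apply, Submodule.mem_comap, Submodule.mem_inf, hG, true_and,
      Submodule.restrictScalars_mem]
    exact hker G hG'
  have hfr : Module.finrank ℚ ↥(LinearMap.ker ev) =
      Module.finrank ℚ ↥(W ⊓ 𝔭.restrictScalars ℚ) := by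
    rw [hkerW]
    exact LinearEquiv.finrank_eq (Submodule.comapSubtypeEquivOfLe inf_le_left)
  have hrn := LinearMap.finrank_range_add_finrank_ker ev
  rw [hfr] at hrn
  have hrange : r ≤ Module.finrank ℚ ↥(LinearMap.range ev) :=
    Nat.le_of_add_le_add_right (hr.trans_eq hrn.symm :
      r + Module.finrank ℚ ↥(W ⊓ 𝔭.restrictScalars ℚ) ≤
        Module.finrank ℚ ↥(LinearMap.range ev) + Module.finrank ℚ ↥(W ⊓ 𝔭.restrictScalars ℚ))
  -- the values of the monomials of degree `δ` span the range of `ev`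
  set S : Set ↥(IntermediateField.adjoin ℚ (Set.range b')) :=
    (fun d : Fin (m + 1) →₀ ℕ => aeval a (monomial d (1 : ℚ))) '' {d | d.degree = δ} with hS
  have hspan : LinearMap.range ev = Submodule.span ℚ S := by
    rw [hev, LinearMap.range_comp, Submodule.range_subtype, hW,
      homogeneousSubmodule_eq_finsupp_supported, AddMonoidAlgebra.supported_eq_span_single,
      Submodule.map_span, ← Set.image_comp]
    rfl
  have hN : r ≤ Module.finrank ℚ ↥(Submodule.span ℚ S) := by
    rw [← hspan]
    exact hrange
  obtain ⟨f, hf, -, hli⟩ := Submodule.exists_fun_fin_finrank_span_eq ℚ S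
  choose d hd hfd using hf
  have hval : ∀ i, f i = ∏ l : Fin m, (b l.succ / b 0) ^ d i l.succ := by
    intro i
    rw [← hfd i]
    simp only [aeval_monomial, map_one, one_mul, Finsupp.prod_pow, Fin.prod_univ_succ, ha,
      div_self hb0, one_pow, one_mul]
  refine ⟨fun j l => d (Fin.castLE hN j) l.succ, fun j => ?_, ?_⟩
  · -- total degree `≤ δ`
    show ∑ l : Fin m, d (Fin.castLE hN j) l.succ ≤ δ
    have h : (d (Fin.castLE hN j)).degree = δ := hd (Fin.castLE hN j)
    rw [Finsupp.degree_eq_sum, Fin.sum_univ_succ] at h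
    exact (Nat.le_add_left _ _).trans_eq h
  · -- linear independence
    show LinearIndependent ℚ fun j => ∏ l : Fin m, (b l.succ / b 0) ^ d (Fin.castLE hN j) l.succ
    have h : (fun j => ∏ l : Fin m, (b l.succ / b 0) ^ d (Fin.castLE hN j) l.succ) =
        f ∘ Fin.castLE hN :=
      funext fun j => (hval _).symm
    rw [h]
    exact hli.comp _ (Fin.castLE_injective hN)

end Span

/-! ## §2  The registered stub -/

/-- **Stub — `ZeroDimDictionaryDeficient`**: the structure of a homogeneous prime
`𝔭 ⊂ ℚ[x₀, …, x_m]` of rank `1` in Nesterenko's elimination language, with the constant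
`c(m) = m(m+1)/2 + log(m+1)`: `K = ℚ(b̄)` the field of a normalised zero `b̄` (`b_j = 1`),
(A) `V(𝔭) = {λ σ(b̄)}`, (B′) distinct embeddings give distinct points, (B) `[K:ℚ] = deg 𝔭`,
(C) `h_K(b̄) ≤ h(𝔭) + c deg 𝔭`, (D) `|𝔭(ω̄)| ≥ e^{−c deg 𝔭} ∏_σ ‖ω̄ − σ(b̄)‖`, (E) interpolation in
degree `δ` ⇒ the monomials of degree `≤ δ` in `b̄/b₀` span `K`, (E′) `r ≤ H(𝔭; δ)` ⇒ `r`
`ℚ`-independent monomials of degree `≤ δ` in `b̄/b₀`. [cite: NesterenkoPhilippon2001, Ch. 3 §4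
(Prop. 4.4, Def. 4.6, Prop. 4.13, property 3 of `|I(ω̄)|`), §5 (p. 42); Philippon1986Criteres,
§1] -/
theorem stub_zeroDimDictionaryDeficient : ZeroDimDictionaryDeficient := by
  intro m hm
  have hlog : (0 : ℝ) < Real.log (m + 1) :=
    Real.log_pos (by exact_mod_cast (by omega : 1 < m + 1))
  refine ⟨(Fintype.card (Fin 1 × SkewIdx m) : ℝ) + Real.log (m + 1),
    add_pos_of_nonneg_of_pos (Nat.cast_nonneg _) hlog, ?_⟩
  intro 𝔭 h𝔭 hhom hunm
  classical
  -- a normalised zero `b̄'`, `b'_j = 1`, and its field `K = ℚ(b̄')`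
  obtain ⟨β₀, hβ₀⟩ := projZeros_nonempty' h𝔭 hhom hunm
  obtain ⟨j, hj0⟩ := Function.ne_iff.mp hβ₀.1
  have hb' : (β₀ j)⁻¹ • β₀ ∈ projZeros 𝔭 :=
    Literature.NumberTheory.Transcendental.PhilipponMain.smul_mem_projZeros
      (fun P hP k => homogeneousComponent_mem_of_mem hhom hP k) hβ₀ (inv_ne_zero hj0)
  have hj : ((β₀ j)⁻¹ • β₀) j = 1 := by
    rw [Pi.smul_apply, smul_eq_mul, inv_mul_cancel₀ hj0]
  haveI := numberField_adjoin h𝔭 hhom hunm hb' hj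
  let b : Fin (m + 1) → ↥(IntermediateField.adjoin ℚ (Set.range ((β₀ j)⁻¹ • β₀))) := fun k =>
    ⟨((β₀ j)⁻¹ • β₀) k, IntermediateField.subset_adjoin ℚ _ ⟨k, rfl⟩⟩
  have hb : ∀ k, (b k : ℂ) = ((β₀ j)⁻¹ • β₀) k := fun k => rfl
  have hbj : b j = 1 := Subtype.ext (by rw [hb, hj]; rfl)
  refine ⟨↥(IntermediateField.adjoin ℚ (Set.range ((β₀ j)⁻¹ • β₀))), inferInstance, inferInstance,
    b, ?_, ?_, ?_, ?_, ?_, ?_, ?_, ?_⟩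
  · -- `b ≠ 0`
    intro h
    have := congrFun h j
    rw [hbj] at this
    exact one_ne_zero this
  · -- (A)
    exact fun β => mem_projZeros_iff h𝔭 hhom hunm hb' hj hb β
  · -- (B′)
    exact fun σ τ l h => embedding_eq_of_proportional hj hb σ τ l h
  · -- (B)
    exact finrank_eq_ideg h𝔭 hhom hunm hb' hj hb
  · -- (C)
    refine (logHeight_le h𝔭 hhom hunm hb' hj hb).trans ?_
    gcongr
    exact le_add_of_nonneg_left (Nat.cast_nonneg _)
  · -- (D)
    exact fun ω hω => exp_mul_prod_projDist_le_iabs h𝔭 hhom hunm hb' hj hb hω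
  · -- (E)
    exact fun hb0 δ hH z => exists_poly_of_interpolation h𝔭 hhom hunm hb' hj hb hb0 δ hH z
  · -- (E′)
    exact fun hb0 δ r hr => exists_linearIndependent_monomials h𝔭 hhom hunm hb' hj hb hb0 δ r hr

end Summit.Schanuel.Schanuel.Cruxes.ApproximationProperty.OrbitInterpolationDeterminant

end
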